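/-
Copyright (c) 2026. All rights reserved.
Released under Apache 2.0 license as described in the file LICENSE.
Authors: abc-iut cell, seat abc-iut-L4-t10 (gen 4; block W2-B4 model column, nodes `AbsTopIII:Cor4.5(iii)`,
`(v)`: the `TM` twins of `AutHolLogFrobeniusCor45FullModelProofs.lean`).
-/
import Literature.AnabelianGeometry.AbsoluteAnabelian.AbsTopIII.AutHolLogFrobeniusCor45FullModelProofs
import Literature.AnabelianGeometry.AbsoluteAnabelian.AbsTopIII.AutHolLogFrobeniusCor45iiiCompatModelProofs
import Literature.AnabelianGeometry.AbsoluteAnabelian.AbsTopIII.AutHolLogFrobeniusCor45vCompatModelProofs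
import HarnessLib

/-!
# [AbsTopIII] Cor 4.5 (v), third sentence, and the full corollary modulo the telecore half of (iii), at
# the archimedean model `𝒳 = 𝒞^hol_TM` ("where `T ∈ {TM, TF}`")

S. Mochizuki, *Topics in Absolute Anabelian Geometry III*, Cor 4.5 pp. 107–109 (kurims manuscript, lit key
`paper:url-5493eb38cbb7`; bib key `MochizukiAbsTopIII2015`); Cor 4.5 is stated for "`𝒳 := 𝒞^hol_T` …
where `T ∈ {TM, TF}`" (p. 107).  PROOF-ONLY file: the `TM` twins of seat abc-iut-L4-t10's
`AutHolLogFrobeniusCor45FullModelProofs.lean` (p438765, `T = TF`), which were held back there only because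
the modules `AutHolLogFrobeniusCor45iiiCompatModelProofs` (p438427: `archTM_iotaOverGaloisStmt`,
`cor_4_5_iii_compat_arch_TM_of_telecore`) and `AutHolLogFrobeniusCor45vCompatModelProofs` (p436692:
`cor_4_5_v_compat_arch_TM_of_shiftCompat`) were not yet built.

* `AbsTopIII.cor_4_5_v_shiftCompat_arch_TM` — the third sentence of (v) (`ShiftCompatStmt`) at the `TM`
  model (abc-iut-w5-d226's `archLogFrobeniusDataTM 𝔄`) for EVERY `𝔄`, ZERO binders: abc-iut-w6-d023's
  `shiftCompatStmt_of_iotaOverGaloisStmt` at gen 4's `archTM_iotaOverGaloisStmt`.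
* `AbsTopIII.cor_4_5_v_compat_arch_TM` — sentences 3 ∧ 4 of (v), zero binders.
* `AbsTopIII.cor_4_5_full_arch_TM_iff_of_cor_4_5`, `cor_4_5_full_arch_TM_iff_logObsCompatTelecore` — at
  the `TM` model too, given the five items (resp. `𝕏₀ : EA` and `IsIdRigid EA`, abc-iut-w5-d226's
  `cor_4_5_arch_TM`), `Cor_4_5_full` holds IFF the telecore half of the (iii) clause does.

HONEST SCOPE: as in the `TF` file — model-level ≠ node-level ≠ reconstruction; nothing here bears on
[IUTchIII] Cor. 3.12 or takes a side; typed ≠ proved.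
-/

namespace Literature.AnabelianGeometry.AbsoluteAnabelian

open _root_.CategoryTheory

universe u

namespace AbsTopIII

variable (𝔄 : AutHolFieldFunctor.{u})

/-- **[AbsTopIII] Cor 4.5 (v), third sentence, at the archimedean MODEL `𝒳 = 𝒞^hol_TM`** for EVERY
interface datum `𝔄`, with NO further hypothesis (`IotaOverGaloisStmt` holds there: `archTM_iotaOverGaloisStmt`).
[cite: MochizukiAbsTopIII2015, Corollary 4.5 (v) p.109] -/
theorem cor_4_5_v_shiftCompat_arch_TM : (archLogFrobeniusDataTM 𝔄).ShiftCompatStmt :=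
  (archLogFrobeniusDataTM 𝔄).shiftCompatStmt_of_iotaOverGaloisStmt (archTM_iotaOverGaloisStmt 𝔄)

/-- **Cor 4.5 (v), third AND fourth sentences (`Cor_4_5_v_compat`) at the `TM` model, every `𝔄`, ZERO
binders.** [cite: MochizukiAbsTopIII2015, Corollary 4.5 (v) p.109] -/
theorem cor_4_5_v_compat_arch_TM : Cor_4_5_v_compat (archLogFrobeniusDataTM 𝔄) (archTelecoreDataTM 𝔄) :=
  cor_4_5_v_compat_arch_TM_of_shiftCompat 𝔄 (cor_4_5_v_shiftCompat_arch_TM 𝔄)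

/-- **Cor 4.5 (v) with ALL its sentences at the `TM` model** from `𝕏₀ : EA` and `IsIdRigid EA`
(abc-iut-w5-d226's `cor_4_5_arch_TM` for the first two sentences).
[cite: MochizukiAbsTopIII2015, Corollary 4.5 (v) p.109] -/
theorem cor_4_5_v_all_arch_TM (X₀ : 𝔄.EA) (hE : IsIdRigid 𝔄.EA) :
    Cor_4_5_v (archLogFrobeniusDataTM 𝔄) ∧
      Cor_4_5_v_compat (archLogFrobeniusDataTM 𝔄) (archTelecoreDataTM 𝔄) :=
  ⟨((cor_4_5_iff _ _).mp (cor_4_5_arch_TM 𝔄 X₀ hE)).2.2.2.2, cor_4_5_v_compat_arch_TM 𝔄⟩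

/-- **At the `TM` model, given the five typed items, `Cor_4_5_full` holds IFF the telecore half of the
(iii) compatibility clause does** (cores half: `cor_4_5_iii_compatCores_arch_TM`; (v): above).
[cite: MochizukiAbsTopIII2015, Corollary 4.5 pp.107–109] -/
theorem cor_4_5_full_arch_TM_iff_of_cor_4_5
    (h : Cor_4_5 (archLogFrobeniusDataTM 𝔄) (archTelecoreDataTM 𝔄)) :
    Cor_4_5_full (archLogFrobeniusDataTM 𝔄) (archTelecoreDataTM 𝔄) ↔
      (archLogFrobeniusDataTM 𝔄).LogObsCompatTelecoreStmt (archTelecoreDataTM 𝔄) :=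
  ⟨fun hf => hf.2.1.2,
    fun ht => ⟨h, cor_4_5_iii_compat_arch_TM_of_telecore 𝔄 ht, cor_4_5_v_compat_arch_TM 𝔄⟩⟩

/-- `Cor_4_5_full` at the `TM` model from `𝕏₀ : EA`, `IsIdRigid EA` and the telecore half of (iii) ONLY.
[cite: MochizukiAbsTopIII2015, Corollary 4.5 pp.107–109] -/
theorem cor_4_5_full_arch_TM_of_logObsCompatTelecore (X₀ : 𝔄.EA) (hE : IsIdRigid 𝔄.EA)
    (ht : (archLogFrobeniusDataTM 𝔄).LogObsCompatTelecoreStmt (archTelecoreDataTM 𝔄)) :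
    Cor_4_5_full (archLogFrobeniusDataTM 𝔄) (archTelecoreDataTM 𝔄) :=
  (cor_4_5_full_arch_TM_iff_of_cor_4_5 𝔄 (cor_4_5_arch_TM 𝔄 X₀ hE)).mpr ht

/-- At the `TM` model, given `𝕏₀ : EA` and `IsIdRigid EA`, the full corollary is EQUIVALENT to the
telecore half of the (iii) clause. [cite: MochizukiAbsTopIII2015, Corollary 4.5 pp.107–109] -/
theorem cor_4_5_full_arch_TM_iff_logObsCompatTelecore (X₀ : 𝔄.EA) (hE : IsIdRigid 𝔄.EA) :
    Cor_4_5_full (archLogFrobeniusDataTM 𝔄) (archTelecoreDataTM 𝔄) ↔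
      (archLogFrobeniusDataTM 𝔄).LogObsCompatTelecoreStmt (archTelecoreDataTM 𝔄) :=
  cor_4_5_full_arch_TM_iff_of_cor_4_5 𝔄 (cor_4_5_arch_TM 𝔄 X₀ hE)

end AbsTopIII

end Literature.AnabelianGeometry.AbsoluteAnabelian
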